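import Literature.Barriers.Parity.SiegelZeroDichotomyPairHLMertens33
import HarnessLib

/-!
# (3.3) beyond the sieve level: `∑_{p ≤ z} min(σ log_R p, 1)/p` for `z` possibly larger than `R`

Topic `Literature/Barriers/Parity`, sub-namespace `TaoTeravainen`; companion of
`SiegelZeroDichotomyPairHLMertens33.lean`. In the proof of Tao–Teräväinen's (5.7)
(arXiv:2109.06291, §5) the Euler product runs over the primes `p ≤ √(2x)`, beyond the sieve level
`R`, and (3.3) is used in the form "`∏_{p ≤ √(2x)} E_p(σ) ≪ (1 + σ log_R √(2x))^{O(1)} E_{p₀}(σ)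
≪ (log_R^{O(1)} x) σ^{O(1)} E_{p₀}(σ)`": only powers of `log_R x` are lost. PROVED here:

* **`sum_min_div_prime_le_general`** — for `2 ≤ M`, `R ≥ 3`, `σ ≥ 1`:
  `∑_{p ≤ M} min(σ log p/log R, 1)/p ≤ 40 log(1+σ) + log(max(1, log M/log R)) + 25`
  (the primes `≤ ⌊R⌋` by the previous file, the primes in `(⌊R⌋, M]` by the two-sided Mertens theorem).
[cite: TaoTeravainen2021, §3.1 (3.3); §5 (proof of (5.7))]
-/

noncomputable section

open Finset Real

namespace Literature.Barriers.Parity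

namespace TaoTeravainen

/-- **(3.3) for arbitrary `z`**: for `2 ≤ M`, `R ≥ 3`, `σ ≥ 1`,
`∑_{p ≤ M} min(σ log p/log R, 1)/p ≤ 40 log(1+σ) + log(max(1, log M/log R)) + 25`
(for `M < R` this is the previous lemma; for `M ≥ R` the primes in `(R, M]` add
`∑_{R < p ≤ M} 1/p ≤ log(log M/log R) + O(1)` by Mertens' theorem — in the source's form
"`∏_{p ≤ √(2x)} E_p(σ) ≪ (1 + σ log_R √(2x))^{O(1)}`", i.e. losses of only `log_R^{O(1)} x`).
[cite: TaoTeravainen2021, §3.1 (3.3) and §5 (proof of (5.7))] -/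
theorem sum_min_div_prime_le_general {M : ℕ} (hM : 2 ≤ M) {R σ : ℝ} (hR : 3 ≤ R) (hσ : 1 ≤ σ) :
    ∑ p ∈ Nat.primesBelow (M + 1), min (σ * Real.log p / Real.log R) 1 / p ≤
      40 * Real.log (1 + σ) + Real.log (max 1 (Real.log M / Real.log R)) + 25 := by
  have hM2 : (2 : ℝ) ≤ M := by exact_mod_cast hM
  have hσ0 : 0 < σ := by linarith
  have hlogR : 0 < Real.log R := Real.log_pos (by linarith)
  have hlogM : 0 < Real.log M := Real.log_pos (by linarith)
  have hmax0 : 0 ≤ Real.log (max 1 (Real.log M / Real.log R)) := Real.log_nonneg (le_max_left _ _)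
  have hlog2 : (0.6931471803 : ℝ) < Real.log 2 := Real.log_two_gt_d9
  have hlog2u : Real.log 2 < 0.6931471808 := Real.log_two_lt_d9
  -- monotonicity in the ratio
  have hmono : ∀ {r : ℝ}, 0 ≤ r → r ≤ 1 → 40 * Real.log (1 + σ * r) ≤ 40 * Real.log (1 + σ) := by
    intro r hr0 hr1
    refine mul_le_mul_of_nonneg_left (Real.log_le_log (by positivity) ?_) (by norm_num)
    nlinarith
  set g : ℕ → ℝ := fun p => min (σ * Real.log p / Real.log R) 1 / p with hg
  have hg0 : ∀ p : ℕ, p.Prime → 0 ≤ g p := fun p hp => by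
    have : (2 : ℝ) ≤ p := by exact_mod_cast hp.two_le
    exact div_nonneg (le_min (by positivity) zero_le_one) (by linarith)
  have hg1 : ∀ p : ℕ, p.Prime → g p ≤ (p : ℝ)⁻¹ := fun p hp => by
    have hp0 : (0 : ℝ) < p := by exact_mod_cast hp.pos
    simp only [hg]
    rw [div_le_iff₀ hp0, inv_mul_cancel₀ hp0.ne']
    exact min_le_right _ _
  rcases lt_or_ge (M : ℝ) R with hMR | hRM
  · -- `M < R`
    have hL : Real.log M ≤ Real.log R := Real.log_le_log (by linarith) hMR.le
    have h := sum_min_div_prime_le_log hM hσ hL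
    have hr1 : Real.log M / Real.log R ≤ 1 := by rwa [div_le_one hlogR]
    have hr0 : 0 ≤ Real.log M / Real.log R := by positivity
    have := hmono hr0 hr1
    rw [mul_div_assoc] at h
    linarith
  · -- `R ≤ M`: split at `M₁ = ⌊R⌋`
    set M₁ := ⌊R⌋₊ with hM₁
    have hR0 : 0 ≤ R := by linarith
    have hM₁3 : 3 ≤ M₁ := Nat.le_floor (by exact_mod_cast hR)
    have hM₁R : (M₁ : ℝ) ≤ R := Nat.floor_le hR0
    have hM₁M : M₁ ≤ M := by
      have : (M₁ : ℝ) ≤ M := hM₁R.trans hRM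
      exact_mod_cast this
    have hM₁2 : (2 : ℝ) ≤ M₁ := by exact_mod_cast (show 2 ≤ M₁ by omega)
    have hsub : Nat.primesLE M₁ ⊆ Nat.primesBelow (M + 1) := by
      intro p hp
      rw [Nat.primesLE, Nat.mem_primesBelow, Nat.lt_succ_iff] at hp
      rw [Nat.mem_primesBelow, Nat.lt_succ_iff]
      exact ⟨hp.1.trans hM₁M, hp.2⟩
    rw [← Finset.sum_sdiff hsub]
    -- part 1: primes `≤ M₁ ≤ R`
    have hpart1 : ∑ p ∈ Nat.primesLE M₁, g p ≤ 40 * Real.log (1 + σ) := by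
      have hL : Real.log M₁ ≤ Real.log R := Real.log_le_log (by linarith) hM₁R
      have h := sum_min_div_prime_le_log (show 2 ≤ M₁ by omega) hσ hL
      have hr1 : Real.log M₁ / Real.log R ≤ 1 := by rwa [div_le_one hlogR]
      have hr0 : 0 ≤ Real.log M₁ / Real.log R := by
        have := Real.log_nonneg (by linarith : (1 : ℝ) ≤ M₁); positivity
      have := hmono hr0 hr1
      rw [mul_div_assoc] at h
      exact h.trans this
    -- part 2: primes in `(M₁, M]`
    have hpart2 : ∑ p ∈ Nat.primesBelow (M + 1) \ Nat.primesLE M₁, g p ≤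
        Real.log (max 1 (Real.log M / Real.log R)) + 25 := by
      have hle : ∑ p ∈ Nat.primesBelow (M + 1) \ Nat.primesLE M₁, g p ≤
          ∑ p ∈ Nat.primesBelow (M + 1) \ Nat.primesLE M₁, (p : ℝ)⁻¹ :=
        Finset.sum_le_sum fun p hp => hg1 p (Nat.mem_primesBelow.mp (Finset.mem_sdiff.mp hp).1).2
      refine hle.trans ?_
      have hdiff : ∑ p ∈ Nat.primesBelow (M + 1) \ Nat.primesLE M₁, (p : ℝ)⁻¹ =
          Literature.NumberTheory.LFunctions.Mertens.primeRecipSum M -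
            Literature.NumberTheory.LFunctions.Mertens.primeRecipSum M₁ := by
        rw [Literature.NumberTheory.LFunctions.Mertens.primeRecipSum,
          Literature.NumberTheory.LFunctions.Mertens.primeRecipSum, Nat.floor_natCast,
          Nat.floor_natCast, eq_sub_iff_add_eq]
        exact sum_sdiff hsub
      rw [hdiff]
      have h1 := Literature.NumberTheory.LFunctions.Mertens.abs_primeRecipSum_sub_le hM2
      have h2 := Literature.NumberTheory.LFunctions.Mertens.abs_primeRecipSum_sub_le hM₁2
      rw [abs_le] at h1 h2
      have hlog2' : 0 < Real.log 2 := by linarith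
      have hlogM₁ : Real.log 2 ≤ Real.log M₁ := Real.log_le_log two_pos hM₁2
      have hlogM2 : Real.log 2 ≤ Real.log M := Real.log_le_log two_pos hM2
      have e1 : 8 / Real.log M ≤ 8 / Real.log 2 := div_le_div_of_nonneg_left (by norm_num) hlog2' hlogM2
      have e2 : 8 / Real.log M₁ ≤ 8 / Real.log 2 := div_le_div_of_nonneg_left (by norm_num) hlog2' hlogM₁
      have e3 : 8 / Real.log 2 ≤ 12 := by rw [div_le_iff₀ hlog2']; linarith
      -- `log log M - log log M₁ ≤ log 2 + log(max 1 (log M/log R))` since `log M₁ ≥ log R / 2`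
      have hlogM₁R : Real.log R / 2 ≤ Real.log M₁ := by
        -- `M₁ ≥ R - 1 ≥ 2R/3`, `log(3/2) ≤ log R / 2` as `R ≥ 3 ≥ 9/4`
        have hM₁ge : R - 1 ≤ M₁ := by
          have := Nat.lt_floor_add_one R
          rw [← hM₁] at this; linarith
        have h23 : 2 * R / 3 ≤ M₁ := by linarith
        have hlog1 : Real.log (2 * R / 3) ≤ Real.log M₁ := Real.log_le_log (by linarith) h23
        have hlog2R : Real.log (2 * R / 3) = Real.log R - Real.log (3 / 2) := by
          rw [show 2 * R / 3 = R / (3 / 2) by ring, Real.log_div (by linarith) (by norm_num)]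
        have hlog32 : Real.log (3 / 2) ≤ Real.log R / 2 := by
          have : Real.log (3 / 2) * 2 = Real.log ((3 / 2) ^ 2) := by rw [Real.log_pow]; ring
          have h9 : Real.log ((3 / 2 : ℝ) ^ 2) ≤ Real.log R := Real.log_le_log (by norm_num) (by norm_num; linarith)
          linarith
        linarith
      have hll : Real.log (Real.log M) - Real.log (Real.log M₁) ≤
          Real.log 2 + Real.log (max 1 (Real.log M / Real.log R)) := by
        have hlogM₁0 : 0 < Real.log M₁ := by linarith
        rw [← Real.log_div hlogM.ne' hlogM₁0.ne', ← Real.log_mul (by norm_num) (by positivity)]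
        refine Real.log_le_log (by positivity) ?_
        calc Real.log M / Real.log M₁ ≤ Real.log M / (Real.log R / 2) :=
              div_le_div_of_nonneg_left hlogM.le (by positivity) hlogM₁R
          _ = 2 * (Real.log M / Real.log R) := by field_simp
          _ ≤ 2 * max 1 (Real.log M / Real.log R) := by
              exact mul_le_mul_of_nonneg_left (le_max_right _ _) (by norm_num)
      linarith
    linarith [hpart1, hpart2]

end TaoTeravainen

end Literature.Barriers.Parity
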